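import Mathlib
import HarnessLib
import Literature.Probability.MarkovChains.PeskunOrdering
import Literature.Probability.MarkovChains.QMatrix

/-!
# The two-level (multilevel) algorithm: Lüscher–Weisz's factorization lemma and the correctness of sub-lattice averages

HONEST FRAMING: exact (Metropolis-corrected) sampling algorithms for lattice gauge theory; figures
of merit are autocorrelation/cost numbers at stated couplings and volumes; no continuum-physics claim.

Source: M. Lüscher, P. Weisz, *Locality and exponential error reduction in numerical lattice gauge
theory*, JHEP 09 (2001) 010 = hep-lat/0108014 [LuscherWeisz2001] (held text
`paper:arxiv-hep-lat_0108014`; Appendix A = chunks p0005–p0006, §§3–4 = chunks p0002–p0003).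
Appendix A "establish[es] the correctness of the two-level simulation algorithm defined in sect. 4"
on an ABSTRACT FINITE MODEL (A.1: "an abstract system … with a finite number of states `s`. Each
state is characterized by a vector `(s₀,s₁,…,s_n)` of discrete variables, whose joint probability
distribution is of the factorized form `p(s) = p₀(s₀) Π_{k=1}^n p_k(s₀,s_k)` (A.1),
`Σ_{s₀} p₀(s₀) = Σ_{s_k} p_k(s₀,s_k) = 1` (A.2)"), for FACTORIZED OBSERVABLES
`𝒪(s) = 𝒪₀(s₀) Π_{k=1}^n 𝒪_k(s₀,s_k)` (A.3) — "this model fits the case of interest if we identify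
`s₀` with the space-like link variables at all even times, `s₁` with the link variables in the
interior of the time-slice `[0,2a]`, `s₂` with those in `[2a,4a]`, and so on", the `𝒪_k` being the
two-link operators `𝕋` of §3 and `[𝒪_k]` the sub-lattice expectation values (3.5)–(3.7) entering the
Polyakov-loop correlator (3.8).  This file formalizes Appendix A as printed (finite sums throughout;
everything PROVED, 0 named facts), in the vocabulary of `PeskunOrdering.lean` (`pathSum P n x F` =
the law of `(X₁,…,X_n)` for the chain `P` started at `x`), `TotalVariation.lean` (`IsRowStochastic`)
and `MetropolisHastings.lean` (`IsStationary`):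

* `pathWeight P n x ω = p_{x ω₁} p_{ω₁ ω₂} ⋯ p_{ω_{n−1} ω_n}` with `pathSum_eq_sum_pathWeight`
  (`pathSum P n x F = Σ_ω pathWeight P n x ω · F ω`), `sum_pathWeight` (total mass one),
  `sum_pathWeight_mul_ite` (the time-`(j+1)` marginal is `P^{j+1}(x,·)`) [cite: Norris1997, §1.1
  Thm 1.1.1 eq. (1.1) and Thm 1.1.3 (ii)] — bookkeeping for the product path laws below (the
  invariance `πPᵐ = π` is the tree's `sum_mul_pow_apply_of_isStationary` of `QMatrix.lean`);
* the abstract model: `factorizedLaw p₀ p s₀ s = p₀(s₀) Π_k p_k(s₀,s_k)` (A.1) on the state space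
  `S₀ × Π_k S_k` (dependent finite types `S k`), `sum_factorizedLaw` ((A.2) ⇒ total mass one),
  `factorizedObs 𝒪₀ 𝒪` (A.3), `subExpectation p 𝒪 k s₀ = [𝒪_k](s₀) = Σ_{s_k} p_k(s₀,s_k) 𝒪_k(s₀,s_k)`
  (A.5), and **eq. (A.4)** `LuscherWeisz2001_eq_A_4`:
  **`⟨𝒪⟩ = Σ_{s₀} p₀(s₀) 𝒪₀(s₀) Π_{k=1}^n [𝒪_k](s₀)`** [cite: LuscherWeisz2001, App. A.1 eqs.
  (A.1)–(A.3); App. A.4 eqs. (A.4)–(A.5)];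
* the two-level simulation of App. A.2: at fixed `s₀` each `s_k` is updated by its own kernel
  `K k s₀` on `S k` ("the transition probability for changing `s_k` at fixed `s₀` is independent of
  the current values of all other variables"), preserving `p_k(s₀,·)` ("the algorithm simulates, and
  thus preserves, the conditional probability distribution `p_k(s₀,s_k)`"); in the second part of a
  cycle `n₂` updates of `s₁,…,s_n` generate `n₂` configurations `W k : Fin n₂ → S k` of each `s_k`
  separately, jointly distributed — given the state `(s₀,s)` at the start of that part — by the
  PRODUCT of the path laws, `innerWeight K n₂ s₀ s W = Π_k pathWeight (K k s₀) n₂ (s k) (W k)` (the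
  statistical independence of the `s_k`-updates at fixed `s₀`); `sum_innerWeight` (mass one);
* **LEMMA A.1 (factorization lemma)** `LuscherWeisz2001_lemma_A_1`: if `(s₁,…,s_n)` is distributed
  with the conditional probability `p₁(s₀,s₁)⋯p_n(s₀,s_n)` at the start of the inner part, then EACH
  of the `(n₂)ⁿ` generated vectors `(W₁(j₁),…,W_n(j_n))` is distributed with the same conditional
  probability: **`Σ_s Π_k p_k(s₀,s_k) · E_s[G(W₁(j₁),…,W_n(j_n))] = Σ_y Π_k p_k(s₀,y_k) · G(y)`** for
  every choice `j : Π_k Fin n₂` and every test function `G` [cite: LuscherWeisz2001, App. A.3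
  Lemma A.1 (with its proof: "the initial values of these variables are already properly
  distributed, and since they are statistically independent, …")];
* App. A.4: the estimate of `[𝒪_k](s₀)` is "the average over the `n₂` configurations of `s_k` that
  are generated in the second part of each update cycle", `innerAverage 𝒪 n₂ k s₀ (W k)`; "the
  average over the `(n₂)ⁿ` configurations in any one of these sets is trivially given by the product
  of the averages of the factors" — `LuscherWeisz2001_prod_innerAverage`
  (`Π_k innerAverage = (n₂ⁿ)⁻¹ Σ_{j : Π_k Fin n₂} Π_k 𝒪_k(s₀, W_k(j_k))`); the two-level estimator of
  one cycle `twoLevelObs 𝒪₀ 𝒪 n₂ s₀ W = 𝒪₀(s₀) Π_k innerAverage` and its conditional expectation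
  `twoLevelMean K 𝒪₀ 𝒪 n₂ s₀ s = Σ_W innerWeight · twoLevelObs` given the state at the start of the
  inner part; `sum_prod_mul_pathSum_innerAverage` (per factor: `Σ_{s_k} p_k E_{s_k}[innerAverage] =
  [𝒪_k](s₀)`, stationarity of `p_k(s₀,·)` under `K k s₀`), and the **CORRECTNESS THEOREM**
  `LuscherWeisz2001_twoLevel_expectation`: for states `(s₀,s)` distributed with probability `p(s)`
  ("the states `s` at the end of the `n₁` full updates in each cycle are distributed with probability
  `p(s)`"), **`E_p[ 𝒪₀(s₀) Π_k (average of 𝒪_k over the n₂ inner configurations) ] = ⟨𝒪⟩`** — "the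
  expectation value `⟨𝒪⟩` may be obtained by substituting stochastic estimates for the factors
  `[𝒪_k](s₀)` on the right-hand side of eq. (A.4) and by averaging the so calculated product over the
  sequence of values of `s₀`" [cite: LuscherWeisz2001, App. A.4 (eqs. (A.4)–(A.6) and the two
  closing paragraphs); App. A.2 (the update cycle)].

SCOPE / `TODO(general form)`: the link variables of the paper are continuous (compact gauge group);
as in the paper's own Appendix A the model here has finitely many states.  The convergence of the
average "over the sequence of values of `s₀`" (ergodicity of the full update cycle) is not part of
Appendix A's argument and is not treated; the identity proved is the expectation identity in the
stationary regime, exactly what Lemma A.1 and App. A.4 assert.  The hierarchical (multi-level,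
sect. 3.3) version is the two-level statement applied recursively and is not spelled out.
-/

namespace Literature.Probability.MarkovChains

open Finset Matrix

noncomputable section

/-! ## Path weights: the law of `(X₁,…,X_n)` as an explicit function on paths -/

section PathWeight

variable {X : Type*}

/-- The weight `p_{x ω₁} p_{ω₁ω₂} ⋯ p_{ω_{n−1}ω_n}` of the path `ω = (ω₁,…,ω_n)` for the chain `P`
started at `x`. [cite: Norris1997, §1.1 Theorem 1.1.1 eq. (1.1)] -/
def pathWeight (P : Matrix X X ℝ) : (n : ℕ) → X → (Fin n → X) → ℝ
  | 0, _, _ => 1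
  | n + 1, x, ω => P x (ω 0) * pathWeight P n (ω 0) (Fin.tail ω)

/-- The weight of a path through its first step. [cite: Norris1997, §1.1 Theorem 1.1.1 eq. (1.1)] -/
theorem pathWeight_succ_cons (P : Matrix X X ℝ) (n : ℕ) (x y : X) (ω : Fin n → X) :
    pathWeight P (n + 1) x (vecCons y ω) = P x y * pathWeight P n y ω := by
  have ht : Fin.tail (vecCons y ω) = ω := funext fun i => by simp [Fin.tail]
  show P x (vecCons y ω 0) * pathWeight P n (vecCons y ω 0) (Fin.tail (vecCons y ω)) = _
  rw [ht, cons_val_zero]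

/-- Path weights are nonnegative for a nonnegative kernel (the path law is a probability).
[cite: Norris1997, §1.1 Theorem 1.1.1 eq. (1.1) (a product of transition probabilities)] -/
theorem pathWeight_nonneg {P : Matrix X X ℝ} (hP : ∀ x y, 0 ≤ P x y) (n : ℕ) :
    ∀ (x : X) (ω : Fin n → X), 0 ≤ pathWeight P n x ω := by
  induction n with
  | zero => intro x ω; exact zero_le_one
  | succ n ih => intro x ω; exact mul_nonneg (hP _ _) (ih _ _)

variable [Fintype X]

/-- `pathSum` is the expectation under the path weights:
`E_x[F(X₁,…,X_n)] = Σ_ω p_{xω₁}⋯p_{ω_{n−1}ω_n} F(ω)`. [cite: Norris1997, §1.1 Theorem 1.1.1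
eq. (1.1)] -/
theorem pathSum_eq_sum_pathWeight (P : Matrix X X ℝ) (n : ℕ) :
    ∀ (x : X) (F : (Fin n → X) → ℝ), pathSum P n x F = ∑ ω, pathWeight P n x ω * F ω := by
  induction n with
  | zero =>
      intro x F
      rw [Fintype.sum_unique]
      simp only [pathSum, pathWeight, one_mul]
      exact congrArg F (Subsingleton.elim _ _)
  | succ n ih =>
      intro x F
      rw [pathSum_succ]
      rw [← Fintype.sum_equiv (Fin.consEquiv fun _ => X)
        (fun q : X × (Fin n → X) => pathWeight P (n + 1) x (vecCons q.1 q.2) * F (vecCons q.1 q.2))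
        (fun ω => pathWeight P (n + 1) x ω * F ω) (fun q => rfl)]
      rw [Fintype.sum_prod_type]
      refine sum_congr rfl fun y _ => ?_
      rw [ih, mul_sum]
      refine sum_congr rfl fun ω _ => ?_
      rw [pathWeight_succ_cons, mul_assoc]

/-- The path law has total mass one. [cite: Norris1997, §1.1 Theorem 1.1.1 (proof: "summing both
sides over `i_N ∈ I` and using `Σ_j p_ij = 1`")] -/
theorem sum_pathWeight {P : Matrix X X ℝ} (hP : IsRowStochastic P) (n : ℕ) (x : X) :
    ∑ ω, pathWeight P n x ω = 1 := by
  have h := pathSum_const hP n x 1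
  rw [pathSum_eq_sum_pathWeight] at h
  simpa using h

/-- ONE-TIME MARGINALS of the path law: the `j`-th generated configuration (time `j+1`) has law
`P^{j+1}(x,·)`. [cite: Norris1997, §1.1 Theorem 1.1.3 (ii)] -/
theorem sum_pathWeight_mul_ite [DecidableEq X] {P : Matrix X X ℝ} (hP : IsRowStochastic P) (n : ℕ)
    (x : X) (j : Fin n) (y : X) :
    ∑ ω, pathWeight P n x ω * (if ω j = y then 1 else 0) = (P ^ (j.val + 1)) x y := by
  rw [← pathSum_eq_sum_pathWeight P n x (fun ω => if ω j = y then (1 : ℝ) else 0),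
    pathSum_coord hP n x (fun z => if z = y then (1 : ℝ) else 0) j]
  simp only [mulVec, dotProduct, mul_ite, mul_one, mul_zero, sum_ite_eq', mem_univ, if_true]

end PathWeight

/-! ## A.1 Abstract model -/

section AbstractModel

variable {S₀ : Type*} {ι : Type*} [Fintype ι] {S : ι → Type*}

/-- **(A.1)** the factorized joint law `p(s) = p₀(s₀) Π_{k=1}^n p_k(s₀,s_k)` of the state
`s = (s₀,s₁,…,s_n)`. [cite: LuscherWeisz2001, App. A.1 eq. (A.1)] -/
def factorizedLaw (p₀ : S₀ → ℝ) (p : ∀ k, S₀ → S k → ℝ) (s₀ : S₀) (s : ∀ k, S k) : ℝ :=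
  p₀ s₀ * ∏ k, p k s₀ (s k)

/-- **(A.3)** a factorized observable `𝒪(s) = 𝒪₀(s₀) Π_{k=1}^n 𝒪_k(s₀,s_k)`.
[cite: LuscherWeisz2001, App. A.1 eq. (A.3)] -/
def factorizedObs (O₀ : S₀ → ℝ) (O : ∀ k, S₀ → S k → ℝ) (s₀ : S₀) (s : ∀ k, S k) : ℝ :=
  O₀ s₀ * ∏ k, O k s₀ (s k)

/-- Unfolding of (A.1). [cite: LuscherWeisz2001, App. A.1 eq. (A.1)] -/
theorem factorizedLaw_apply (p₀ : S₀ → ℝ) (p : ∀ k, S₀ → S k → ℝ) (s₀ : S₀) (s : ∀ k, S k) :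
    factorizedLaw p₀ p s₀ s = p₀ s₀ * ∏ k, p k s₀ (s k) := rfl

/-- Unfolding of (A.3). [cite: LuscherWeisz2001, App. A.1 eq. (A.3)] -/
theorem factorizedObs_apply (O₀ : S₀ → ℝ) (O : ∀ k, S₀ → S k → ℝ) (s₀ : S₀) (s : ∀ k, S k) :
    factorizedObs O₀ O s₀ s = O₀ s₀ * ∏ k, O k s₀ (s k) := rfl

/-- `p ≥ 0` when its factors are. [cite: LuscherWeisz2001, App. A.1 eq. (A.1)] -/
theorem factorizedLaw_nonneg {p₀ : S₀ → ℝ} {p : ∀ k, S₀ → S k → ℝ} (h₀ : ∀ s₀, 0 ≤ p₀ s₀)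
    (h : ∀ k s₀ x, 0 ≤ p k s₀ x) (s₀ : S₀) (s : ∀ k, S k) : 0 ≤ factorizedLaw p₀ p s₀ s :=
  mul_nonneg (h₀ _) (prod_nonneg fun k _ => h k _ _)

variable [∀ k, Fintype (S k)]

/-- **(A.5)** the sub-lattice expectation value `[𝒪_k](s₀) = Σ_{s_k} p_k(s₀,s_k) 𝒪_k(s₀,s_k)` — a
function of the boundary variables `s₀` only. [cite: LuscherWeisz2001, App. A.4 eq. (A.5); §3.2
eqs. (3.5)–(3.7) (sub-lattice expectation values "are well-defined functions of the link variables
at the boundary of the sublattice")] -/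
def subExpectation (p : ∀ k, S₀ → S k → ℝ) (O : ∀ k, S₀ → S k → ℝ) (k : ι) (s₀ : S₀) : ℝ :=
  ∑ x, p k s₀ x * O k s₀ x

variable [Fintype S₀] [DecidableEq ι]

/-- **(A.2) ⇒ `p` is a probability**: `Σ_s p(s) = 1` when `Σ_{s₀} p₀ = 1` and
`Σ_{s_k} p_k(s₀,s_k) = 1`. [cite: LuscherWeisz2001, App. A.1 eq. (A.2)] -/
theorem sum_factorizedLaw {p₀ : S₀ → ℝ} {p : ∀ k, S₀ → S k → ℝ} (h₀ : ∑ s₀, p₀ s₀ = 1)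
    (h : ∀ k s₀, ∑ x, p k s₀ x = 1) :
    ∑ s₀, ∑ s : ∀ k, S k, factorizedLaw p₀ p s₀ s = 1 := by
  simp only [factorizedLaw]
  rw [← h₀]
  refine sum_congr rfl fun s₀ _ => ?_
  rw [← mul_sum, ← Fintype.prod_sum (fun k x => p k s₀ x)]
  simp [h]

/-- **Eq. (A.4)**: the expectation value of the factorized observable (A.3) is
**`⟨𝒪⟩ = Σ_{s₀} p₀(s₀) 𝒪₀(s₀) Π_{k=1}^n [𝒪_k](s₀)`**. [cite: LuscherWeisz2001, App. A.4
eqs. (A.4)–(A.5)] -/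
theorem LuscherWeisz2001_eq_A_4 (p₀ : S₀ → ℝ) (p : ∀ k, S₀ → S k → ℝ) (O₀ : S₀ → ℝ)
    (O : ∀ k, S₀ → S k → ℝ) :
    ∑ s₀, ∑ s : ∀ k, S k, factorizedLaw p₀ p s₀ s * factorizedObs O₀ O s₀ s
      = ∑ s₀, p₀ s₀ * O₀ s₀ * ∏ k, subExpectation p O k s₀ := by
  refine sum_congr rfl fun s₀ _ => ?_
  simp only [factorizedLaw, factorizedObs, subExpectation]
  rw [Fintype.prod_sum (fun k x => p k s₀ x * O k s₀ x), mul_sum]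
  refine sum_congr rfl fun s _ => ?_
  rw [prod_mul_distrib]
  ring

end AbstractModel

/-! ## A.2 Two-level simulation and A.3 the factorization lemma -/

section TwoLevel

variable {S₀ : Type*} {ι : Type*} [Fintype ι] {S : ι → Type*}

/-- The CONDITIONAL LAW of the `(n₂)ⁿ` inner configurations: given the state `(s₀,s)` at the start of
the second part of a cycle, the `n₂` successive configurations `W k : Fin n₂ → S k` of each `s_k`
(generated by `n₂` updates with the kernel `K k s₀` at fixed `s₀`) are independent across `k`, each
with its path law — the product `Π_k pathWeight (K k s₀) n₂ (s k) (W k)` ("the transition probability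
for changing `s_k` at fixed `s₀` is independent of the current values of all other variables … the
algorithm effectively generates `n₂` configurations of each `s_k` separately").
[cite: LuscherWeisz2001, App. A.2] -/
def innerWeight (K : ∀ k, S₀ → Matrix (S k) (S k) ℝ) (n₂ : ℕ) (s₀ : S₀) (s : ∀ k, S k)
    (W : ∀ k, Fin n₂ → S k) : ℝ :=
  ∏ k, pathWeight (K k s₀) n₂ (s k) (W k)

/-- Unfolding of `innerWeight`. [cite: LuscherWeisz2001, App. A.2] -/
theorem innerWeight_apply (K : ∀ k, S₀ → Matrix (S k) (S k) ℝ) (n₂ : ℕ) (s₀ : S₀) (s : ∀ k, S k)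
    (W : ∀ k, Fin n₂ → S k) :
    innerWeight K n₂ s₀ s W = ∏ k, pathWeight (K k s₀) n₂ (s k) (W k) := rfl

/-- It is nonnegative. [cite: LuscherWeisz2001, App. A.2] -/
theorem innerWeight_nonneg {K : ∀ k, S₀ → Matrix (S k) (S k) ℝ} {s₀ : S₀}
    (hK : ∀ k, ∀ x y : S k, 0 ≤ K k s₀ x y) (n₂ : ℕ) (s : ∀ k, S k) (W : ∀ k, Fin n₂ → S k) :
    0 ≤ innerWeight K n₂ s₀ s W :=
  prod_nonneg fun k _ => pathWeight_nonneg (hK k) _ _ _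

/-- The estimate of `[𝒪_k](s₀)`: "the average over the `n₂` configurations of `s_k` that are
generated in the second part of each update cycle". [cite: LuscherWeisz2001, App. A.4 (last
paragraph)] -/
def innerAverage (O : ∀ k, S₀ → S k → ℝ) (n₂ : ℕ) (k : ι) (s₀ : S₀) (w : Fin n₂ → S k) : ℝ :=
  (∑ i, O k s₀ (w i)) / n₂

/-- The two-level estimator of one update cycle: the right-hand side of (A.4) with the stochastic
estimates substituted for the factors `[𝒪_k](s₀)`, i.e. `𝒪₀(s₀) Π_k innerAverage`.
[cite: LuscherWeisz2001, App. A.4 ("substituting stochastic estimates for the factors `[𝒪_k](s₀)`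
on the right-hand side of eq. (A.4)")] -/
def twoLevelObs (O₀ : S₀ → ℝ) (O : ∀ k, S₀ → S k → ℝ) (n₂ : ℕ) (s₀ : S₀)
    (W : ∀ k, Fin n₂ → S k) : ℝ :=
  O₀ s₀ * ∏ k, innerAverage O n₂ k s₀ (W k)

/-- "The average over the `(n₂)ⁿ` configurations in any one of these sets is trivially given by the
product of the averages of the factors `𝒪_k(s₀,s_k)`." [cite: LuscherWeisz2001, App. A.4 (after
eq. (A.6))] -/
theorem LuscherWeisz2001_prod_innerAverage [DecidableEq ι] (O : ∀ k, S₀ → S k → ℝ) (n₂ : ℕ)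
    (s₀ : S₀) (W : ∀ k, Fin n₂ → S k) :
    ∏ k, innerAverage O n₂ k s₀ (W k)
      = (∑ i : ι → Fin n₂, ∏ k, O k s₀ (W k (i k))) / (n₂ : ℝ) ^ Fintype.card ι := by
  simp only [innerAverage, div_eq_mul_inv]
  rw [prod_mul_distrib, Fintype.prod_sum (fun k (i : Fin n₂) => O k s₀ (W k i)), prod_const,
    card_univ, inv_pow]

variable [∀ k, Fintype (S k)] [DecidableEq ι]

/-- The conditional law of the inner configurations has total mass one.
[cite: LuscherWeisz2001, App. A.2] -/
theorem sum_innerWeight {K : ∀ k, S₀ → Matrix (S k) (S k) ℝ} {s₀ : S₀}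
    (hK : ∀ k, IsRowStochastic (K k s₀)) (n₂ : ℕ) (s : ∀ k, S k) :
    ∑ W : ∀ k, Fin n₂ → S k, innerWeight K n₂ s₀ s W = 1 := by
  simp only [innerWeight]
  rw [← Fintype.prod_sum (fun k (w : Fin n₂ → S k) => pathWeight (K k s₀) n₂ (s k) w)]
  simp [sum_pathWeight (hK _)]

/-- The expectation of a PRODUCT test function under the product path law factorizes.
[cite: LuscherWeisz2001, App. A.2–A.3 ("statistically independent")] -/
theorem sum_innerWeight_mul_prod (K : ∀ k, S₀ → Matrix (S k) (S k) ℝ) (n₂ : ℕ) (s₀ : S₀)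
    (s : ∀ k, S k) (g : ∀ k, (Fin n₂ → S k) → ℝ) :
    ∑ W : ∀ k, Fin n₂ → S k, innerWeight K n₂ s₀ s W * ∏ k, g k (W k)
      = ∏ k, ∑ w : Fin n₂ → S k, pathWeight (K k s₀) n₂ (s k) w * g k w := by
  rw [Fintype.prod_sum (fun k (w : Fin n₂ → S k) => pathWeight (K k s₀) n₂ (s k) w * g k w)]
  refine sum_congr rfl fun W _ => ?_
  rw [innerWeight, prod_mul_distrib]

/-- The conditional expectation of the two-level estimator given the state `(s₀,s)` at the start of
the inner part of the cycle (expectation under `innerWeight`). [cite: LuscherWeisz2001, App. A.2,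
A.4] -/
def twoLevelMean (K : ∀ k, S₀ → Matrix (S k) (S k) ℝ) (O₀ : S₀ → ℝ) (O : ∀ k, S₀ → S k → ℝ)
    (n₂ : ℕ) (s₀ : S₀) (s : ∀ k, S k) : ℝ :=
  ∑ W : ∀ k, Fin n₂ → S k, innerWeight K n₂ s₀ s W * twoLevelObs O₀ O n₂ s₀ W

/-- The conditional expectation of the two-level estimator factorizes over the variables:
`E_{(s₀,s)}[𝒪₀ Π_k innerAverage_k] = 𝒪₀(s₀) Π_k E_{s_k}[innerAverage_k]` (independence of the inner
updates). [cite: LuscherWeisz2001, App. A.2–A.4] -/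
theorem twoLevelMean_eq (K : ∀ k, S₀ → Matrix (S k) (S k) ℝ) (O₀ : S₀ → ℝ)
    (O : ∀ k, S₀ → S k → ℝ) (n₂ : ℕ) (s₀ : S₀) (s : ∀ k, S k) :
    twoLevelMean K O₀ O n₂ s₀ s
      = O₀ s₀ * ∏ k, pathSum (K k s₀) n₂ (s k) (innerAverage O n₂ k s₀) := by
  have h := sum_innerWeight_mul_prod K n₂ s₀ s (fun k w => innerAverage O n₂ k s₀ w)
  simp only [twoLevelMean, twoLevelObs]
  simp_rw [pathSum_eq_sum_pathWeight]
  rw [← h, mul_sum]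
  exact sum_congr rfl fun W _ => by ring

variable [∀ k, DecidableEq (S k)]

/-- LEMMA A.1, law form: started from the conditional law `Π_k p_k(s₀,·)`, the probability that the
selected vector `(W₁(j₁),…,W_n(j_n))` equals `y` is `Π_k p_k(s₀,y_k)`.
[cite: LuscherWeisz2001, App. A.3 Lemma A.1 (proof)] -/
theorem LuscherWeisz2001_lemma_A_1_law {K : ∀ k, S₀ → Matrix (S k) (S k) ℝ}
    {p : ∀ k, S₀ → S k → ℝ} {s₀ : S₀} (hK : ∀ k, IsRowStochastic (K k s₀))
    (hst : ∀ k, IsStationary (p k s₀) (K k s₀)) (n₂ : ℕ) (j : ι → Fin n₂) (y : ∀ k, S k) :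
    ∑ s : ∀ k, S k, (∏ k, p k s₀ (s k)) *
        ∑ W : ∀ k, Fin n₂ → S k, innerWeight K n₂ s₀ s W *
          (if (fun k => W k (j k)) = y then (1 : ℝ) else 0)
      = ∏ k, p k s₀ (y k) := by
  -- the indicator of the selected vector is the product of the coordinate indicators
  have hind : ∀ W : ∀ k, Fin n₂ → S k,
      (if (fun k => W k (j k)) = y then (1 : ℝ) else 0) = ∏ k, if W k (j k) = y k then (1 : ℝ) else 0 := by
    intro W
    by_cases h : (fun k => W k (j k)) = y
    · rw [if_pos h]
      exact (prod_eq_one fun k _ => by rw [if_pos (congrFun h k)]).symm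
    · rw [if_neg h]
      have h' : ¬ ∀ k, W k (j k) = y k := fun hall => h (funext hall)
      obtain ⟨k, hk⟩ := not_forall.mp h'
      exact (prod_eq_zero (mem_univ k) (if_neg hk)).symm
  -- independence: the expectation of the product indicator factorizes over `k`
  have h2 : ∀ s : ∀ k, S k,
      ∑ W : ∀ k, Fin n₂ → S k, innerWeight K n₂ s₀ s W *
          ∏ k, (if W k (j k) = y k then (1 : ℝ) else 0)
        = ∏ k, ∑ w : Fin n₂ → S k, pathWeight (K k s₀) n₂ (s k) w *
            (if w (j k) = y k then (1 : ℝ) else 0) :=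
    fun s => sum_innerWeight_mul_prod K n₂ s₀ s (fun k w => if w (j k) = y k then (1 : ℝ) else 0)
  -- per variable: the law of the `j_k`-th generated configuration started at `x` is `K^{j_k+1}(x,·)`
  have h3 : ∀ (k : ι) (x : S k),
      ∑ w : Fin n₂ → S k, pathWeight (K k s₀) n₂ x w * (if w (j k) = y k then (1 : ℝ) else 0)
        = ((K k s₀) ^ ((j k).val + 1)) x (y k) :=
    fun k x => sum_pathWeight_mul_ite (hK k) n₂ x (j k) (y k)
  simp_rw [hind, h2, h3, ← prod_mul_distrib]
  rw [← Fintype.prod_sum (fun k (x : S k) => p k s₀ x * ((K k s₀) ^ ((j k).val + 1)) x (y k))]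
  -- stationarity of `p_k(s₀,·)` under the powers of `K k s₀`
  exact prod_congr rfl fun k _ => sum_mul_pow_apply_of_isStationary (hst k) _ _  -- `QMatrix.lean`

/-- **LEMMA A.1 (factorization lemma).** "The vectors `(s₁,…,s_n)` in the sets with the same value
of `s₀` occur with conditional probability `p₁(s₀,s₁)⋯p_n(s₀,s_n)`": if at the start of the inner
part `(s₁,…,s_n)` has the conditional law `Π_k p_k(s₀,·)` (a law preserved by each `K k s₀`), then
for every selection `j` of one generated configuration per variable, the vector
`(W₁(j₁),…,W_n(j_n))` again has the law `Π_k p_k(s₀,·)` — tested against an arbitrary `G`.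
[cite: LuscherWeisz2001, App. A.3 Lemma A.1 (statement and proof: "the initial values of these
variables are already properly distributed, and since they are statistically independent, …")] -/
theorem LuscherWeisz2001_lemma_A_1 {K : ∀ k, S₀ → Matrix (S k) (S k) ℝ} {p : ∀ k, S₀ → S k → ℝ}
    {s₀ : S₀} (hK : ∀ k, IsRowStochastic (K k s₀)) (hst : ∀ k, IsStationary (p k s₀) (K k s₀))
    (n₂ : ℕ) (j : ι → Fin n₂) (G : (∀ k, S k) → ℝ) :
    ∑ s : ∀ k, S k, (∏ k, p k s₀ (s k)) *
        ∑ W : ∀ k, Fin n₂ → S k, innerWeight K n₂ s₀ s W * G (fun k => W k (j k))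
      = ∑ y : ∀ k, S k, (∏ k, p k s₀ (y k)) * G y := by
  -- `G(v) = Σ_y 1[v = y] G(y)`
  have hsel : ∀ W : ∀ k, Fin n₂ → S k,
      G (fun k => W k (j k))
        = ∑ y : ∀ k, S k, (if (fun k => W k (j k)) = y then (1 : ℝ) else 0) * G y := by
    intro W
    simp only [ite_mul, one_mul, zero_mul, sum_ite_eq, mem_univ, if_true]
  have hL : ∑ s : ∀ k, S k, (∏ k, p k s₀ (s k)) *
        ∑ W : ∀ k, Fin n₂ → S k, innerWeight K n₂ s₀ s W * G (fun k => W k (j k))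
      = ∑ s : ∀ k, S k, ∑ W : ∀ k, Fin n₂ → S k, ∑ y : ∀ k, S k,
          (∏ k, p k s₀ (s k)) * (innerWeight K n₂ s₀ s W *
            ((if (fun k => W k (j k)) = y then (1 : ℝ) else 0) * G y)) := by
    refine sum_congr rfl fun s _ => ?_
    rw [mul_sum]
    refine sum_congr rfl fun W _ => ?_
    rw [hsel W, mul_sum, mul_sum]
  rw [hL]
  calc ∑ s : ∀ k, S k, ∑ W : ∀ k, Fin n₂ → S k, ∑ y : ∀ k, S k,
          (∏ k, p k s₀ (s k)) * (innerWeight K n₂ s₀ s W *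
            ((if (fun k => W k (j k)) = y then (1 : ℝ) else 0) * G y))
      = ∑ y : ∀ k, S k, ∑ s : ∀ k, S k, ∑ W : ∀ k, Fin n₂ → S k,
          (∏ k, p k s₀ (s k)) * (innerWeight K n₂ s₀ s W *
            ((if (fun k => W k (j k)) = y then (1 : ℝ) else 0) * G y)) := by
        refine (sum_congr rfl fun s _ => sum_comm).trans ?_
        rw [sum_comm]
    _ = ∑ y : ∀ k, S k, G y * ∑ s : ∀ k, S k, (∏ k, p k s₀ (s k)) *
          ∑ W : ∀ k, Fin n₂ → S k, innerWeight K n₂ s₀ s W *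
            (if (fun k => W k (j k)) = y then (1 : ℝ) else 0) := by
        refine sum_congr rfl fun y _ => ?_
        rw [mul_sum]
        refine sum_congr rfl fun s _ => ?_
        rw [mul_sum, mul_sum]
        exact sum_congr rfl fun W _ => by ring
    _ = ∑ y : ∀ k, S k, G y * ∏ k, p k s₀ (y k) :=
        sum_congr rfl fun y _ => by rw [LuscherWeisz2001_lemma_A_1_law hK hst n₂ j y]
    _ = ∑ y : ∀ k, S k, (∏ k, p k s₀ (y k)) * G y := sum_congr rfl fun y _ => mul_comm _ _

/-! ## A.4 Expectation values: the two-level estimator is exact in the mean -/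

omit [Fintype ι] [DecidableEq ι] in
/-- Per factor: started from the preserved law `p_k(s₀,·)`, the expected inner average IS the
sub-lattice expectation value, `Σ_{s_k} p_k(s₀,s_k) E_{s_k}[innerAverage_k] = [𝒪_k](s₀)` (`n₂ ≥ 1`).
[cite: LuscherWeisz2001, App. A.4 with Lemma A.1] -/
theorem sum_mul_pathSum_innerAverage {K : ∀ k, S₀ → Matrix (S k) (S k) ℝ}
    {p : ∀ k, S₀ → S k → ℝ} {s₀ : S₀} (hK : ∀ k, IsRowStochastic (K k s₀))
    (hst : ∀ k, IsStationary (p k s₀) (K k s₀)) (O : ∀ k, S₀ → S k → ℝ) {n₂ : ℕ} (hn : n₂ ≠ 0)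
    (k : ι) :
    ∑ x : S k, p k s₀ x * pathSum (K k s₀) n₂ x (innerAverage O n₂ k s₀)
      = subExpectation p O k s₀ := by
  have hdiv : ∀ x : S k, pathSum (K k s₀) n₂ x (innerAverage O n₂ k s₀)
      = pathSum (K k s₀) n₂ x (fun w => ∑ i, O k s₀ (w i)) / n₂ := by
    intro x
    rw [show innerAverage O n₂ k s₀ = fun w => (∑ i, O k s₀ (w i)) / (n₂ : ℝ) from rfl,
      pathSum_eq_sum_pathWeight, pathSum_eq_sum_pathWeight, sum_div]
    exact sum_congr rfl fun w _ => (mul_div_assoc _ _ _).symm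
  simp_rw [hdiv, mul_div_assoc', ← sum_div]
  rw [sum_mul_pathSum_ergodicSum (hK k) (hst k) n₂ (O k s₀),
    mul_div_cancel_left₀ _ (Nat.cast_ne_zero.2 hn)]
  rfl

variable [Fintype S₀]

/-- **CORRECTNESS OF THE TWO-LEVEL ALGORITHM (App. A.4).** For states `(s₀,s)` distributed with
the factorized probability `p(s)` (A.1) — "the states `s` at the end of the `n₁` full updates in
each cycle are distributed with probability `p(s)`" — and inner kernels `K k s₀` that are
stochastic and preserve `p_k(s₀,·)`, the two-level estimator `𝒪₀(s₀) Π_k` (average of `𝒪_k` over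
the `n₂ ≥ 1` inner configurations of `s_k`) has expectation **`⟨𝒪⟩`**: "the expectation value
`⟨𝒪⟩` may be obtained by substituting stochastic estimates for the factors `[𝒪_k](s₀)` on the
right-hand side of eq. (A.4) and by averaging the so calculated product over the sequence of values
of `s₀`". [cite: LuscherWeisz2001, App. A.4 (eqs. (A.4)–(A.6) and the closing paragraphs), with
App. A.3 Lemma A.1] -/
theorem LuscherWeisz2001_twoLevel_expectation {K : ∀ k, S₀ → Matrix (S k) (S k) ℝ}
    {p₀ : S₀ → ℝ} {p : ∀ k, S₀ → S k → ℝ} (hK : ∀ k s₀, IsRowStochastic (K k s₀))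
    (hst : ∀ k s₀, IsStationary (p k s₀) (K k s₀)) (O₀ : S₀ → ℝ) (O : ∀ k, S₀ → S k → ℝ)
    {n₂ : ℕ} (hn : n₂ ≠ 0) :
    ∑ s₀, ∑ s : ∀ k, S k, factorizedLaw p₀ p s₀ s * twoLevelMean K O₀ O n₂ s₀ s
      = ∑ s₀, ∑ s : ∀ k, S k, factorizedLaw p₀ p s₀ s * factorizedObs O₀ O s₀ s := by
  rw [LuscherWeisz2001_eq_A_4]
  refine sum_congr rfl fun s₀ _ => ?_
  simp_rw [twoLevelMean_eq, factorizedLaw]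
  rw [← prod_congr rfl fun k _ => sum_mul_pathSum_innerAverage (hK · s₀) (hst · s₀) O hn k,
    Fintype.prod_sum (fun k (x : S k) =>
      p k s₀ x * pathSum (K k s₀) n₂ x (innerAverage O n₂ k s₀)), mul_sum]
  refine sum_congr rfl fun s _ => ?_
  rw [prod_mul_distrib]
  ring

/-- The same statement with **(A.4)** substituted: `E_p[two-level estimator] =
Σ_{s₀} p₀(s₀) 𝒪₀(s₀) Π_k [𝒪_k](s₀)`. [cite: LuscherWeisz2001, App. A.4 eqs. (A.4)–(A.6)] -/
theorem LuscherWeisz2001_twoLevel_expectation' {K : ∀ k, S₀ → Matrix (S k) (S k) ℝ}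
    {p₀ : S₀ → ℝ} {p : ∀ k, S₀ → S k → ℝ} (hK : ∀ k s₀, IsRowStochastic (K k s₀))
    (hst : ∀ k s₀, IsStationary (p k s₀) (K k s₀)) (O₀ : S₀ → ℝ) (O : ∀ k, S₀ → S k → ℝ)
    {n₂ : ℕ} (hn : n₂ ≠ 0) :
    ∑ s₀, ∑ s : ∀ k, S k, factorizedLaw p₀ p s₀ s * twoLevelMean K O₀ O n₂ s₀ s
      = ∑ s₀, p₀ s₀ * O₀ s₀ * ∏ k, subExpectation p O k s₀ := by
  rw [LuscherWeisz2001_twoLevel_expectation hK hst O₀ O hn, LuscherWeisz2001_eq_A_4]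

end TwoLevel

end

end Literature.Probability.MarkovChains
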